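import Literature.AlgebraicGeometry.HodgeTheory.HodgeGroupTwistedHodgeOperators
import Literature.AlgebraicGeometry.HodgeTheory.AbelianVarietyHodgeFullnessRecord
import Literature.AlgebraicGeometry.HodgeTheory.AbelianVarietyHodgeHomFullness
import Literature.FieldTheory.AlgClosed.AutStableSubspaceDescent
import Mathlib.LinearAlgebra.Matrix.ToLin
import HarnessLib

/-!
# The commutant of the Hodge group: rational Hodge endomorphisms (Deligne 1982, I Prop. 3.4) and, on `H¹` of an abelian variety, `End⁰(A) ⊗ ℂ` (I Prop. 5.1, from Riemann's theorem)

Family `hodge`, layer `Literature/AlgebraicGeometry/Deligne1982`; theorems only (no definition, no named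
fact, D-0026). P. Deligne, *Hodge cycles on abelian varieties* (notes by J. S. Milne), LNM 900 (1982):

* I §3, Prop. 3.4 (TeXed re-edition p. 24): the rational tensors fixed by the Mumford–Tate group `G` of
  a rational Hodge structure `V` are exactly the Hodge classes of type `(0,0)`; its proof: `G_ℂ` is
  generated by the conjugates `σμ(𝔾_m)`, `σ ∈ Aut(ℂ)`, of the Hodge cocharacter.
* I §5, proof of Prop. 5.1 (re-ed. p. 36): for an abelian variety `A`, "`E ⊗ ℝ` is the commutant of
  `h(𝕊)` in `End(H₁(A, ℝ))` […] Therefore `E` is the commutant of `G` in `End(H₁(A, ℚ))`", with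
  `E = End⁰(A)` by Riemann's theorem (Deligne–Milne, *Tannakian categories*, LNM 900, II Thm. 6.20:
  `H¹_B` is fully faithful on abelian varieties up to isogeny — the tree's cited record
  `HodgeTheory.DeligneMilne1982_Thm_6_20_full`, binder `hR` of the Hodge-ladder stage 2,
  `Summits/HodgeConjecture/CorCM/Interfaces.lean`).

On the tree's real carriers — complex Betti cohomology `Hᵏ(X(ℂ); ℂ)` with its rational lattice
`Hᵏ(X(ℂ); ℚ) ⊗ 1` (`β = ofRatClassBaseChangeEquiv : Hᵏ(X(ℂ); ℚ) ⊗ ℂ ≃ Hᵏ(X(ℂ); ℂ)`), type pieces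
`M.typePiece` of a Hodge model, and the Tannaka-free Hodge group `hodgeGroup n X` of
`MotivatedGaloisGroup` — we prove:

* `coeffClass_conj_mem_typePiece_of_commute_hodgeGroup` — an endomorphism `x` of `Hᵏ(X(ℂ); ℂ)`
  commuting with `Hg(X)(ℂ)` has ALL its Galois conjugates `σ⁻¹_* ∘ x ∘ σ_*` preserving the Hodge
  decomposition: `x` commutes with the twisted Hodge operators `σ_* h₂ σ⁻¹_* ∈ hodgeGroup n X`
  (`HodgeGroupTwistedHodgeOperators`), so `σ⁻¹_* x σ_*` commutes with `h₂ = Σ 2^{p-q} π_{(p,q)}`, whose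
  eigenspaces are the type pieces (`mem_typePiece_of_hodgeOperator_eq_smul`, the weights `2^{p-q}` being
  distinct on each antidiagonal, `hodgeWeight_two_injective`).
* `mem_span_ratEnd_baseChange_of_commute_hodgeGroup` — **Deligne I Prop. 3.4 for `End(Hᵏ)`**: such an
  `x` is a `ℂ`-linear combination of complexified RATIONAL endomorphisms `β ∘ (ψ ⊗ ℂ) ∘ β⁻¹`,
  `ψ ∈ End_ℚ Hᵏ(X(ℂ); ℚ)`, each preserving every type piece (rational Hodge classes of type `(0,0)` in
  `End(Hᵏ) = Hᵏ ⊗ (Hᵏ)^∨`). Proof: in a rational basis the matrices of the endomorphisms all of whose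
  Galois conjugates preserve the Hodge decomposition form an `Aut(ℂ)`-stable `ℂ`-subspace, which by
  Galois descent over `ℂ` (`Complex.submodule_le_span_fixed_of_forall_ringEquiv`, fixed field
  `ℂ^{Aut(ℂ)} = ℚ` — Borel AG §14; the tree's `FieldTheory/AlgClosed`) is spanned by rational matrices.
* `mem_span_complexBetti_map_of_commute_hodgeGroup_of_riemann` — **Deligne I Prop. 5.1 (proof), granted
  Riemann's theorem**: for a complex abelian variety `A`, every `ℂ`-endomorphism of `H¹(A(ℂ); ℂ)`
  commuting with `Hg(A)(ℂ)|_{H¹}` lies in the `ℂ`-span of the pull-backs `φ^*`, `φ ∈ End A` — each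
  rational Hodge endomorphism `ψ` of `H¹(A(ℂ); ℚ)` is a weight-one Hodge morphism
  (`IsHodgeMorphismOne A A ψ`), hence `k • ψ = u^*` for some `u ∈ End A`, `k ≥ 1`, by the record
  `DeligneMilne1982_Thm_6_20_full`. This is VERBATIM the body of the Hodge-ladder stage-3 residual
  `Summit.HodgeConjecture.HodgeConjecture.Ring2Transport.HodgeGroupH1CommutantSpan`
  (`Summits/…/Theorems/Ring2TransportCMTypeOfCommutativeMumfordTate.lean`), now behind the SAME Riemann
  record `hR` that stage 2 displays: the junction `hR → R` is `fun A x hx ↦ … hR A x hx`.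

## References

* [Deligne1982HodgeCycles] P. Deligne, *Hodge cycles on abelian varieties*, LNM 900 (1982), I §3
  Prop. 3.4 and its proof; I §5 Prop. 5.1 and its proof ("E is the commutant of G in End(H₁(A,ℚ))").
* [DeligneMilne1982Tannakian] P. Deligne, J. S. Milne, *Tannakian categories*, LNM 900 (1982), II
  Thm. 6.20 (Riemann).
* [Borel1991] A. Borel, *Linear Algebraic Groups*, 2nd ed. (1991), AG §14 (`k`-structures and Galois
  descent of subspaces).
-/

noncomputable section

open CategoryTheory Cardinal
open scoped TensorProduct
open Literature.AlgebraicTopology.SingularHomology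
open Literature.AlgebraicGeometry.HodgeTheory Literature.AlgebraicGeometry.Motives
open Literature.FieldTheory.AlgClosed

namespace Literature.AlgebraicGeometry.Deligne1982

section HodgeTheory

variable {n : ℕ} {X : SchemeOver ℂ}

/-! ### The eigenspaces of the Hodge operator `h₂` are the type pieces -/

/-- The weights `2ᵖ 2^{-q}` of the Hodge operator `h₂` are pairwise distinct on each antidiagonal
`p + q = k` (`2^{p-q}` determines `p - q`, hence `(p, q)`). [cite: Deligne1982HodgeCycles, I §3 (the cocharacter `μ`)] -/
theorem hodgeWeight_two_injective {k : ℕ} (t : ℂˣ) (ht : (t : ℂ) = 2)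
    {pq pq' : ↥(Finset.HasAntidiagonal.antidiagonal k)}
    (h : HodgeModel.hodgeWeight t pq = HodgeModel.hodgeWeight t pq') : pq = pq' := by
  have hk := Finset.HasAntidiagonal.mem_antidiagonal.1 pq.2
  have hk' := Finset.HasAntidiagonal.mem_antidiagonal.1 pq'.2
  simp only [HodgeModel.hodgeWeight, Units.val_inv_eq_inv_val, ht] at h
  -- clear the denominators: `2^p · 2^{q'} = 2^{p'} · 2^q`
  have h2 : (2 : ℂ) ≠ 0 := two_ne_zero
  have key : (2 : ℂ) ^ (pq.1.1 + pq'.1.2) = (2 : ℂ) ^ (pq'.1.1 + pq.1.2) := by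
    have e := congrArg (fun z : ℂ ↦ z * (2 : ℂ) ^ pq.1.2 * (2 : ℂ) ^ pq'.1.2) h
    rw [show (2 : ℂ) ^ pq.1.1 * (2 : ℂ)⁻¹ ^ pq.1.2 * (2 : ℂ) ^ pq.1.2 * (2 : ℂ) ^ pq'.1.2 =
        (2 : ℂ) ^ pq.1.1 * (2 : ℂ) ^ pq'.1.2 * ((2 : ℂ)⁻¹ ^ pq.1.2 * (2 : ℂ) ^ pq.1.2) by ring,
      show (2 : ℂ) ^ pq'.1.1 * (2 : ℂ)⁻¹ ^ pq'.1.2 * (2 : ℂ) ^ pq.1.2 * (2 : ℂ) ^ pq'.1.2 =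
        (2 : ℂ) ^ pq'.1.1 * (2 : ℂ) ^ pq.1.2 * ((2 : ℂ)⁻¹ ^ pq'.1.2 * (2 : ℂ) ^ pq'.1.2) by ring,
      ← mul_pow, ← mul_pow, inv_mul_cancel₀ h2, one_pow, one_pow, mul_one, mul_one, ← pow_add,
      ← pow_add] at e
    exact e
  have hnat : pq.1.1 + pq'.1.2 = pq'.1.1 + pq.1.2 := by
    have e : ((2 ^ (pq.1.1 + pq'.1.2) : ℕ) : ℂ) = ((2 ^ (pq'.1.1 + pq.1.2) : ℕ) : ℂ) := by
      push_cast; exact key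
    exact Nat.pow_right_injective (le_refl 2) (Nat.cast_injective e)
  exact Subtype.ext (Prod.ext (by omega) (by omega))

/-- **The eigenspaces of a Hodge operator with distinct weights are the type pieces**: if
`h_t z = w_{(p,q)} z` and no other type on the antidiagonal has the weight `w_{(p,q)}`, then `z` is of
type `(p, q)` (apply the type projectors: `(w_{(p',q')} - w_{(p,q)}) π_{(p',q')} z = 0`).
[cite: Deligne1982HodgeCycles, I §3 (the cocharacter `μ` defines the Hodge decomposition)] -/
theorem mem_typePiece_of_hodgeOperator_eq_smul (M : HodgeModel n X) (t : ℂˣ) {k : ℕ}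
    {pq : ↥(Finset.HasAntidiagonal.antidiagonal k)} {z : complexBetti X k}
    (h : M.hodgeOperator t k z = HodgeModel.hodgeWeight t pq • z)
    (hinj : ∀ pq' : ↥(Finset.HasAntidiagonal.antidiagonal k),
      HodgeModel.hodgeWeight t pq' = HodgeModel.hodgeWeight t pq → pq' = pq) :
    z ∈ M.typePiece k pq := by
  classical
  -- the type components of `h_t z`
  have hproj : ∀ pq', M.typeProj k pq' (M.hodgeOperator t k z) =
      HodgeModel.hodgeWeight t pq' • M.typeProj k pq' z := by
    refine M.typeProj_eq_of_sum_eq (fun pq' ↦ Submodule.smul_mem _ _ (M.typeProj_mem k pq' z)) ?_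
    rw [HodgeModel.hodgeOperator, LinearMap.sum_apply]
    exact Finset.sum_congr rfl fun pq' _ ↦ by rw [LinearMap.smul_apply]
  have hzero : ∀ pq', pq' ≠ pq → M.typeProj k pq' z = 0 := by
    intro pq' hne
    have e := hproj pq'
    rw [h, map_smul] at e
    -- `(w_{pq'} - w_{pq}) • π z = 0`
    have e' : (HodgeModel.hodgeWeight t pq' - HodgeModel.hodgeWeight t pq) • M.typeProj k pq' z = 0 := by
      rw [sub_smul, ← e, sub_self]
    rcases smul_eq_zero.1 e' with hw | hz
    · exact absurd (hinj pq' (sub_eq_zero.1 hw)) hne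
    · exact hz
  have hz : z = M.typeProj k pq z := by
    conv_lhs => rw [← M.sum_typeProj k z]
    rw [Finset.sum_eq_single pq (fun pq' _ hne ↦ hzero pq' hne) (fun hh ↦ absurd (Finset.mem_univ pq) hh)]
  rw [hz]
  exact M.typeProj_mem k pq z

/-- **An endomorphism commuting with the Hodge group has all its Galois conjugates preserving the Hodge
decomposition** (Deligne I §3, proof of Prop. 3.4: commuting with `G(ℂ) ∋ σμ(t)` for all `σ, t`): if
`x ∈ End_ℂ Hᵏ(X(ℂ); ℂ)` commutes with `Hg(X)(ℂ)` in degree `k`, then for every field automorphism `σ`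
of `ℂ` the conjugate `σ⁻¹_* ∘ x ∘ σ_*` maps each type piece `H^{p,q}` into itself.
[cite: Deligne1982HodgeCycles, I §3, Prop. 3.4 and its proof] -/
theorem coeffClass_conj_mem_typePiece_of_commute_hodgeGroup (M : HodgeModel n X)
    (hX : IsSmoothProjective n X) {k : ℕ} (x : complexBetti X k →ₗ[ℂ] complexBetti X k)
    (hx : ∀ g ∈ hodgeGroup n X, ∀ y : complexBetti X k, x (g k y) = g k (x y))
    (σ : ℂ ≃+* ℂ) {pq : ↥(Finset.HasAntidiagonal.antidiagonal k)} {c : complexBetti X k}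
    (hc : c ∈ M.typePiece k pq) :
    coeffClass (R := ℂ) (S := ℂ) σ.symm.toRingHom.toAddMonoidHom k
        (x (coeffClass (R := ℂ) (S := ℂ) σ.toRingHom.toAddMonoidHom k c)) ∈ M.typePiece k pq := by
  set t : ℂˣ := Units.mk0 (2 : ℂ) two_ne_zero with ht
  have htv : (t : ℂ) = 2 := rfl
  refine mem_typePiece_of_hodgeOperator_eq_smul M t ?_ (fun pq' h ↦ hodgeWeight_two_injective t htv h)
  have e := M.coeffClass_apply_hodgeOperator_of_commute_hodgeGroup hX x hx σ t c
  rw [M.hodgeOperator_apply_of_mem t hc, coeffClass_ringHom_smul, map_smul, coeffClass_ringHom_smul] at e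
  rw [← e]
  congr 1
  exact (σ.symm_apply_apply _)

/-- **An endomorphism commuting with the Hodge group preserves the Hodge decomposition** (the case
`σ = 1` of `coeffClass_conj_mem_typePiece_of_commute_hodgeGroup`: `x` commutes with the Hodge operators
`h_t ∈ Hg(X)(ℂ)`, whose eigenspaces are the `H^{p,q}`). [cite: Deligne1982HodgeCycles, I §3, Prop. 3.4] -/
theorem mem_typePiece_of_commute_hodgeGroup (M : HodgeModel n X) (hX : IsSmoothProjective n X) {k : ℕ}
    (x : complexBetti X k →ₗ[ℂ] complexBetti X k)
    (hx : ∀ g ∈ hodgeGroup n X, ∀ y : complexBetti X k, x (g k y) = g k (x y))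
    {pq : ↥(Finset.HasAntidiagonal.antidiagonal k)} {c : complexBetti X k} (hc : c ∈ M.typePiece k pq) :
    x c ∈ M.typePiece k pq := by
  have h := coeffClass_conj_mem_typePiece_of_commute_hodgeGroup M hX x hx (RingEquiv.refl ℂ) hc
  have e : (RingEquiv.refl ℂ).toRingHom.toAddMonoidHom = AddMonoidHom.id ℂ := AddMonoidHom.ext fun _ ↦ rfl
  have e' : (RingEquiv.refl ℂ).symm.toRingHom.toAddMonoidHom = AddMonoidHom.id ℂ :=
    AddMonoidHom.ext fun _ ↦ rfl
  rw [e, e', coeffClass_id, coeffClass_id] at h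
  exact h

/-! ### Descent: the commutant of the Hodge group is spanned by rational Hodge endomorphisms (Deligne I Prop. 3.4 for `End(Hᵏ)`) -/

/-- **Deligne I Prop. 3.4 for the tensor space `End(Hᵏ)`, on the real carriers.** Let `X/ℂ` be smooth
projective of dimension `n`, `M` a Hodge model, `β : Hᵏ(X(ℂ); ℚ) ⊗ ℂ ≃ Hᵏ(X(ℂ); ℂ)` the
complexification of the rational lattice. Every `ℂ`-endomorphism `x` of `Hᵏ(X(ℂ); ℂ)` commuting with
the Hodge group `Hg(X)(ℂ)` in degree `k` is a `ℂ`-linear combination of endomorphisms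
`β ∘ (ψ ⊗ ℂ) ∘ β⁻¹` with `ψ` a RATIONAL endomorphism of `Hᵏ(X(ℂ); ℚ)` whose complexification preserves
every type piece `H^{p,q}` (a rational Hodge class of type `(0,0)` in `End(Hᵏ)`): all Galois conjugates
of `x` preserve the Hodge decomposition (`coeffClass_conj_mem_typePiece_of_commute_hodgeGroup`), so in a
rational basis the matrix of `x` lies in an `Aut(ℂ)`-stable subspace of matrices, which Galois descent
over `ℂ` (`Complex.submodule_le_span_fixed_of_forall_ringEquiv`, `ℂ^{Aut(ℂ)} = ℚ`) spans by rational
matrices. [cite: Deligne1982HodgeCycles, I §3, Prop. 3.4 and its proof] [cite: Borel1991, AG §14.2] -/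
theorem mem_span_ratEnd_baseChange_of_commute_hodgeGroup (hX : IsSmoothProjective n X)
    (M : HodgeModel n X) {k : ℕ} (x : complexBetti X k →ₗ[ℂ] complexBetti X k)
    (hx : ∀ g ∈ hodgeGroup n X, ∀ y : complexBetti X k, x (g k y) = g k (x y)) :
    x ∈ Submodule.span ℂ {y : complexBetti X k →ₗ[ℂ] complexBetti X k |
      ∃ ψ : bettiCohomology X k →ₗ[ℚ] bettiCohomology X k,
        y = (ofRatClassBaseChangeEquiv hX k).toLinearMap ∘ₗ ψ.baseChange ℂ ∘ₗ
            (ofRatClassBaseChangeEquiv hX k).symm.toLinearMap ∧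
        ∀ (pq : ↥(Finset.HasAntidiagonal.antidiagonal k)), ∀ c ∈ M.typePiece k pq, y c ∈ M.typePiece k pq} := by
  classical
  -- a rational basis of `Hᵏ(X(ℂ); ℂ)`
  haveI : Module.Finite ℚ (bettiCohomology X k) := finite_singularCohomology_rat_complexPoints hX k
  set β := ofRatClassBaseChangeEquiv hX k with hβdef
  set d := Module.finrank ℚ (bettiCohomology X k) with hd
  let b : Module.Basis (Fin d) ℚ (bettiCohomology X k) := Module.finBasis ℚ (bettiCohomology X k)
  let Bc : Module.Basis (Fin d) ℂ (ℂ ⊗[ℚ] bettiCohomology X k) := Algebra.TensorProduct.basis ℂ b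
  let B : Module.Basis (Fin d) ℂ (complexBetti X k) := Bc.map β
  have hBc : ∀ i, Bc i = (1 : ℂ) ⊗ₜ b i := fun i ↦ Algebra.TensorProduct.basis_apply b i
  have hB : ∀ i, B i = ofRatClass (ComplexPoints X) k (b i) := fun i ↦ by
    change β (Bc i) = _
    rw [hBc, hβdef, ofRatClassBaseChangeEquiv_apply, ofRatClassBaseChange_tmul, one_smul]
  have hBrat : ∀ i, IsRationalClass (B i) := fun i ↦ by
    rw [hB]; exact isRationalClass_ofRatClass _
  -- (1) coordinates of a coefficient-twisted class are the twisted coordinates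
  have hrepr : ∀ (τ : ℂ →+* ℂ) (v : complexBetti X k) (i : Fin d),
      B.repr (coeffClass (R := ℂ) (S := ℂ) τ.toAddMonoidHom k v) i = τ (B.repr v i) := by
    intro τ v i
    have hv : coeffClass (R := ℂ) (S := ℂ) τ.toAddMonoidHom k v =
        ∑ j, τ (B.repr v j) • B j := by
      conv_lhs => rw [← B.sum_repr v]
      rw [map_sum]
      exact Finset.sum_congr rfl fun j _ ↦ by
        rw [coeffClass_ringHom_smul, (hBrat j).coeffClass_ringHom_eq τ]
    rw [hv, B.repr_sum_self]
  -- (2) the matrix of `x` and of its Galois conjugates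
  set m : Matrix (Fin d) (Fin d) ℂ := LinearMap.toMatrix B B x with hm
  have hconj : ∀ (σ : ℂ ≃+* ℂ) (v : complexBetti X k),
      Matrix.toLin B B (m.map σ) v =
        coeffClass (R := ℂ) (S := ℂ) σ.toRingHom.toAddMonoidHom k
          (x (coeffClass (R := ℂ) (S := ℂ) σ.symm.toRingHom.toAddMonoidHom k v)) := by
    intro σ v
    refine B.ext_elem fun i ↦ ?_
    rw [Matrix.repr_toLin, hrepr, ← LinearMap.toMatrix_mulVec_repr B B x, ← hm]
    simp only [Matrix.mulVec, dotProduct, Matrix.map_apply, map_sum, map_mul]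
    refine Finset.sum_congr rfl fun j _ ↦ ?_
    rw [hrepr]
    congr 1
    exact (σ.apply_symm_apply _).symm
  -- (3) the stable subspace of matrices (flattened to `Fin d × Fin d → ℂ`)
  let Pres : (complexBetti X k →ₗ[ℂ] complexBetti X k) → Prop := fun f ↦
    ∀ (pq : ↥(Finset.HasAntidiagonal.antidiagonal k)), ∀ c ∈ M.typePiece k pq, f c ∈ M.typePiece k pq
  have Pres_add : ∀ f g, Pres f → Pres g → Pres (f + g) := fun f g hf hg pq c hc ↦ by
    rw [LinearMap.add_apply]; exact Submodule.add_mem _ (hf pq c hc) (hg pq c hc)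
  have Pres_smul : ∀ (a : ℂ) f, Pres f → Pres (a • f) := fun a f hf pq c hc ↦ by
    rw [LinearMap.smul_apply]; exact Submodule.smul_mem _ a (hf pq c hc)
  have Pres_zero : Pres 0 := fun pq c _ ↦ by rw [LinearMap.zero_apply]; exact Submodule.zero_mem _
  let toEnd : (Fin d × Fin d → ℂ) →ₗ[ℂ] (complexBetti X k →ₗ[ℂ] complexBetti X k) :=
    { toFun := fun w ↦ Matrix.toLin B B (Matrix.of fun i j ↦ w (i, j))
      map_add' := fun w w' ↦ by
        rw [← map_add]; rfl
      map_smul' := fun a w ↦ by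
        rw [RingHom.id_apply, ← map_smul]; rfl }
  have htoEnd : ∀ w, toEnd w = Matrix.toLin B B (Matrix.of fun i j ↦ w (i, j)) := fun w ↦ rfl
  let S : Submodule ℂ (Fin d × Fin d → ℂ) :=
    { carrier := {w | ∀ σ : ℂ ≃+* ℂ, Pres (toEnd (⇑σ ∘ w))}
      add_mem' := fun {w w'} hw hw' σ ↦ by
        have e : (⇑σ ∘ (w + w')) = (⇑σ ∘ w) + (⇑σ ∘ w') := funext fun ij ↦ map_add σ _ _
        rw [e, map_add]
        exact Pres_add _ _ (hw σ) (hw' σ)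
      zero_mem' := fun σ ↦ by
        have e : (⇑σ ∘ (0 : Fin d × Fin d → ℂ)) = 0 := funext fun ij ↦ map_zero σ
        rw [e, map_zero]
        exact Pres_zero
      smul_mem' := fun a w hw σ ↦ by
        have e : (⇑σ ∘ (a • w)) = σ a • (⇑σ ∘ w) := funext fun ij ↦ map_mul σ _ _
        rw [e, map_smul]
        exact Pres_smul _ _ (hw σ) }
  have hS_mem : ∀ w, w ∈ S ↔ ∀ σ : ℂ ≃+* ℂ, Pres (toEnd (⇑σ ∘ w)) := fun w ↦ Iff.rfl
  have hS : ∀ ρ : ℂ ≃+* ℂ, ∀ w ∈ S, (⇑ρ ∘ w) ∈ S := by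
    intro ρ w hw
    rw [hS_mem]
    intro σ
    have e : (⇑σ ∘ (⇑ρ ∘ w)) = (⇑(ρ.trans σ) ∘ w) := rfl
    rw [e]
    exact (hS_mem w).1 hw (ρ.trans σ)
  -- (4) the flattened matrix of `x` lies in `S`
  set wx : Fin d × Fin d → ℂ := fun ij ↦ m ij.1 ij.2 with hwx
  have hwx_end : ∀ σ : ℂ ≃+* ℂ, toEnd (⇑σ ∘ wx) = Matrix.toLin B B (m.map σ) := fun σ ↦ rfl
  have hwxS : wx ∈ S := by
    rw [hS_mem]
    intro σ pq c hc
    rw [hwx_end, hconj]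
    simpa only [RingEquiv.symm_symm] using
      coeffClass_conj_mem_typePiece_of_commute_hodgeGroup M hX x hx σ.symm hc
  -- (5) Galois descent over `ℂ`: `S` is spanned by its rational matrices
  set F : Subfield ℂ := (Rat.castHom ℂ).fieldRange with hF
  have hFcount : #F ≤ ℵ₀ := by
    rw [Cardinal.mk_le_aleph0_iff, hF]
    exact (Set.countable_range (Rat.castHom ℂ)).to_subtype
  have hdesc := Complex.submodule_le_span_fixed_of_forall_ringEquiv F hFcount S
    (fun ρ _ w hw ↦ hS ρ w hw) hwxS
  -- (6) `x = toEnd wx`, and `toEnd` of a rational matrix of `S` is a rational Hodge endomorphism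
  have hx_eq : x = toEnd wx := by
    rw [htoEnd]
    conv_lhs => rw [← Matrix.toLin_toMatrix B B x]
    rfl
  rw [hx_eq]
  have hmap := Submodule.mem_map_of_mem (f := toEnd) hdesc
  rw [Submodule.map_span] at hmap
  refine Submodule.span_mono ?_ hmap
  rintro _ ⟨w, ⟨hwS, hwF⟩, rfl⟩
  -- the rational matrix `q` with `↑q = w`
  have hq : ∀ ij, ∃ q : ℚ, (q : ℂ) = w ij := fun ij ↦ by
    obtain ⟨q, hq⟩ := RingHom.mem_fieldRange.1 (hF ▸ hwF ij)
    exact ⟨q, hq⟩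
  choose q hq using hq
  let ψ : bettiCohomology X k →ₗ[ℚ] bettiCohomology X k := Matrix.toLin b b (Matrix.of fun i j ↦ q (i, j))
  refine ⟨ψ, ?_, ?_⟩
  · -- `toEnd w = β ∘ (ψ ⊗ ℂ) ∘ β⁻¹`: compare on the rational basis `B j = β (1 ⊗ b j)`
    refine B.ext fun j ↦ ?_
    rw [htoEnd, Matrix.toLin_self]
    have hβB : β.symm (B j) = (1 : ℂ) ⊗ₜ b j := by
      rw [← hBc]
      exact β.symm_apply_eq.2 (Module.Basis.map_apply _ _ _)
    rw [LinearMap.comp_apply, LinearMap.comp_apply, LinearEquiv.coe_toLinearMap,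
      LinearEquiv.coe_toLinearMap, hβB, LinearMap.baseChange_tmul, Matrix.toLin_self,
      TensorProduct.tmul_sum, map_sum]
    refine Finset.sum_congr rfl fun i _ ↦ ?_
    rw [Matrix.of_apply, Matrix.of_apply, ← TensorProduct.smul_tmul, Rat.smul_one_eq_cast, hβdef,
      ofRatClassBaseChangeEquiv_apply, ofRatClassBaseChange_tmul, hq, ← hB]
  · -- `toEnd w` preserves the type pieces: `w ∈ S` at `σ = 1`
    have h1 := (hS_mem w).1 hwS (RingEquiv.refl ℂ)
    exact h1

/-! ### Abelian varieties: the commutant of `Hg(A)(ℂ)` on `H¹` is `End⁰(A) ⊗ ℂ`, granted Riemann's theorem -/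

/-- A rational endomorphism of `H¹(A(ℂ); ℚ)` whose complexification preserves `H^{1,0}` and `H^{0,1}`
(read in a Hodge model) is a morphism of weight-one Hodge structures in the sense of the record
`IsHodgeMorphismOne` (`AbelianVarietyHodgeFullnessRecord`). [cite: DeligneMilne1982Tannakian, II §6 (Hod_ℚ), Thm. 6.20] -/
theorem isHodgeMorphismOne_of_preserves_typePiece (A : AbelianVariety ℂ)
    (M : HodgeModel A.dim A.X) (ψ : bettiCohomology A.X 1 →ₗ[ℚ] bettiCohomology A.X 1)
    (hψ : ∀ (pq : ↥(Finset.HasAntidiagonal.antidiagonal 1)), ∀ c ∈ M.typePiece 1 pq,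
      ((ofRatClassBaseChangeEquiv (AbelianVariety.isSmoothProjective_holds (A := A)) 1).toLinearMap ∘ₗ
          ψ.baseChange ℂ ∘ₗ
        (ofRatClassBaseChangeEquiv (AbelianVariety.isSmoothProjective_holds (A := A)) 1).symm.toLinearMap) c ∈
        M.typePiece 1 pq) :
    IsHodgeMorphismOne A A ψ := by
  have hX : IsSmoothProjective A.dim A.X := AbelianVariety.isSmoothProjective_holds
  set β := ofRatClassBaseChangeEquiv hX 1 with hβ
  -- `β ((ψ ⊗ ℂ) t) = (β ∘ (ψ ⊗ ℂ) ∘ β⁻¹) (β t)`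
  have key : ∀ t : ℂ ⊗[ℚ] bettiCohomology A.X 1,
      ofRatClassBaseChange (ComplexPoints A.X) 1 (ψ.baseChange ℂ t) =
        (β.toLinearMap ∘ₗ ψ.baseChange ℂ ∘ₗ β.symm.toLinearMap)
          (ofRatClassBaseChange (ComplexPoints A.X) 1 t) := by
    intro t
    rw [← ofRatClassBaseChangeEquiv_apply hX, ← ofRatClassBaseChangeEquiv_apply hX, ← hβ]
    simp only [LinearMap.comp_apply, LinearEquiv.coe_toLinearMap, LinearEquiv.symm_apply_apply]
  let p10 : ↥(Finset.HasAntidiagonal.antidiagonal 1) :=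
    ⟨(1, 0), Finset.HasAntidiagonal.mem_antidiagonal.2 rfl⟩
  let p01 : ↥(Finset.HasAntidiagonal.antidiagonal 1) :=
    ⟨(0, 1), Finset.HasAntidiagonal.mem_antidiagonal.2 rfl⟩
  refine ⟨fun t ht ↦ ?_, fun t ht ↦ ?_⟩
  · rw [key]
    exact (M.mem_typePiece_iff_isOfHodgeType' hX p10 _).1
      (hψ p10 _ ((M.mem_typePiece_iff_isOfHodgeType' hX p10 _).2 ht))
  · rw [key]
    exact (M.mem_typePiece_iff_isOfHodgeType' hX p01 _).1
      (hψ p01 _ ((M.mem_typePiece_iff_isOfHodgeType' hX p01 _).2 ht))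

/-- **Deligne 1982, I §5, proof of Prop. 5.1 («E is the commutant of G in End(H₁(A, ℚ))»), granted
Riemann's theorem (Deligne–Milne II Thm. 6.20, the tree's record `DeligneMilne1982_Thm_6_20_full`).** For a
complex abelian variety `A`, every `ℂ`-linear endomorphism of `H¹(A(ℂ); ℂ)` commuting with the Hodge
group `Hg(A)(ℂ)` (the tree's Tannaka-free `hodgeGroup (dim A) A.X`) in degree `1` lies in the `ℂ`-span of
the pull-backs `φ^*`, `φ ∈ End A`: by `mem_span_ratEnd_baseChange_of_commute_hodgeGroup` it is a
combination of complexified rational Hodge endomorphisms `ψ` of `H¹(A(ℂ); ℚ)`; each is a weight-one Hodge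
morphism (`isHodgeMorphismOne_of_preserves_typePiece`), so Riemann's theorem gives `u ∈ End A`, `k ≥ 1`
with `u^* = k • ψ`, i.e. `β ∘ (ψ ⊗ ℂ) ∘ β⁻¹ = k⁻¹ • u^*` on `H¹(A(ℂ); ℂ)`. This is the body of the
Hodge-ladder stage-3 residual `Ring2Transport.HodgeGroupH1CommutantSpan` behind the stage-2 binder `hR`.
[cite: Deligne1982HodgeCycles, I §5 Prop. 5.1 (proof) and I §3 Prop. 3.4] [cite: DeligneMilne1982Tannakian, II Thm. 6.20] -/
theorem mem_span_complexBetti_map_of_commute_hodgeGroup_of_riemann (hR : DeligneMilne1982_Thm_6_20_full)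
    (A : AbelianVariety ℂ) (x : complexBetti A.X 1 →ₗ[ℂ] complexBetti A.X 1)
    (hx : ∀ g ∈ hodgeGroup A.dim A.X, ∀ y : complexBetti A.X 1, x (g 1 y) = g 1 (x y)) :
    x ∈ Submodule.span ℂ (Set.range fun φ : (A ⟶ A) ↦ (complexBetti.map φ.hom.hom.hom 1).hom) := by
  have hX : IsSmoothProjective A.dim A.X := AbelianVariety.isSmoothProjective_holds
  obtain ⟨M⟩ := nonempty_hodgeModel_holds hX
  set β := ofRatClassBaseChangeEquiv hX 1 with hβ
  have h := mem_span_ratEnd_baseChange_of_commute_hodgeGroup hX M x hx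
  refine (Submodule.span_le.2 ?_) h
  rintro y ⟨ψ, rfl, hψ⟩
  -- `ψ` is a weight-one Hodge morphism, hence `k • ψ = u^*` by Riemann's theorem
  have hHM : IsHodgeMorphismOne A A ψ := isHodgeMorphismOne_of_preserves_typePiece A M ψ hψ
  obtain ⟨u, m, hm, hu⟩ := hR A A ψ ⟨M⟩ hHM
  have hψ' : (bettiCohomology.map u.hom.hom.hom 1).hom = (m : ℚ) • ψ := by
    refine LinearMap.ext fun v ↦ ?_
    rw [LinearMap.smul_apply, Nat.cast_smul_eq_nsmul]
    exact hu v
  -- on `H¹(A(ℂ); ℂ)`: `u^* = m • (β ∘ (ψ ⊗ ℂ) ∘ β⁻¹)`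
  have key : (complexBetti.map u.hom.hom.hom 1).hom =
      (m : ℂ) • (β.toLinearMap ∘ₗ ψ.baseChange ℂ ∘ₗ β.symm.toLinearMap) := by
    refine LinearMap.ext fun v ↦ ?_
    obtain ⟨t, rfl⟩ := β.surjective v
    have e := complexBetti_map_ofRatClassBaseChangeEquiv hX hX u.hom.hom.hom (k := 1) t
    rw [← hβ] at e
    change complexBetti.map u.hom.hom.hom 1 (β t) = _
    rw [e, hψ', LinearMap.baseChange_smul, LinearMap.smul_apply, LinearMap.smul_apply]
    simp only [LinearMap.comp_apply, LinearEquiv.coe_toLinearMap, LinearEquiv.symm_apply_apply]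
    rw [← algebraMap_smul ℂ (m : ℚ), map_smul, map_natCast]
  have hm0 : (m : ℂ) ≠ 0 := Nat.cast_ne_zero.2 hm.ne'
  have hy : β.toLinearMap ∘ₗ ψ.baseChange ℂ ∘ₗ β.symm.toLinearMap =
      (m : ℂ)⁻¹ • (complexBetti.map u.hom.hom.hom 1).hom := by
    rw [key, smul_smul, inv_mul_cancel₀ hm0, one_smul]
  rw [hy]
  exact Submodule.smul_mem _ _ (Submodule.subset_span ⟨u, rfl⟩)

end HodgeTheory

end Literature.AlgebraicGeometry.Deligne1982

end
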